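import Summits.QuantumFields.YangMills.Theorems.SandwichVariancePinchingSandwichMomentsLtOne

/-!
# Route `SandwichVariancePinching` — support `SandwichMomentsLt` (stmt-QuantumFields-28320) CLOSED by name

The repaired support (the `SandwichMoments` body with the strict binder `δ < 1`, re-filed by planner ym-idea-3 g12 after
`not_SandwichMoments` refuted the `δ ≤ 1` version) is literally the statement already proved as
`SandwichVariancePinching.sandwichMoments_of_lt_one` (module `…SandwichVariancePinchingSandwichMomentsLtOne`); this file is the
one-line closer whose type is the route decl.

HONEST SCOPE.  Routine support of a draft sub-line onto the open crux `LogConcaveChart.QuadraticCovarianceComparison`; the two cruxes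
`QuadraticVarianceCeiling` / `QuadraticVarianceFloor`, rung R2a and every summit statement stay open; nothing here bears on the
Yang–Mills mass gap.
-/

namespace Summit.QuantumFields.YangMills.Theorems

/-- The route decl `SandwichVariancePinching.SandwichMomentsLt` (stmt-QuantumFields-28320) holds: it is
`SandwichVariancePinching.sandwichMoments_of_lt_one` verbatim (Gaussian domination from the lower pinching with `δ < 1`). [folklore] -/
theorem sandwichVariancePinching_sandwichMomentsLt_proof :
    Summit.QuantumFields.YangMills.Theses.SandwichVariancePinching.SandwichMomentsLt := by
  unfold Summit.QuantumFields.YangMills.Theses.SandwichVariancePinching.SandwichMomentsLt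
  exact SandwichVariancePinching.sandwichMoments_of_lt_one

end Summit.QuantumFields.YangMills.Theorems
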